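import Summits.Schanuel.Schanuel.Theorems.ZilberEacGraphCurveEdge
import Summits.Schanuel.Schanuel.Theorems.ZilberEacRealFibreDensity
import HarnessLib

/-!
# Graph base × arbitrary curve, IV: Zariski density of the exponential points of
# `{x₁ = p(x₀)} × Z(P)` for every `deg p ≥ 2` and every irreducible `P ∉ ℂ[y₀]`

HONEST FRAMING.  Cell `pub-schanuel` (Zilber's Exponential-Algebraic Closedness, case ladder;
host summit Schanuel), seat 2, gen 16.  We answer Mantova–Masser's "unprojected density"
question (D. Masser, V. Mantova, *Polynomial-exponential equations — some new cases of
solvability*, PLMS 129 (2024) = arXiv:2303.05592, §1 p. 5; OPEN in general) on ONE MORE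
EXPLICIT FAMILY of surfaces of their case (dim-π-S-1-free):

  `W(p; P) = {x₁ = p(x₀)} × Z(P) ⊆ ℂ² × ℂ²`, `deg p ≥ 2`, `P ∈ ℂ[y₀, y₁]` irreducible with two
  monomials of different `y₁`-degree — the fibre curve `Z(P)` is ARBITRARY (any genus, any
  singularities) except for the vertical lines `y₀ = r` (for which density is the phase criterion of
  `EACDensityPhases`, and which are exactly the fibres that are not multiplicatively free over a
  graph base).

`unprojectedDense_graphCurveSurface`: the exponential points `(z, p(z), e^z, e^{p(z)})`,
`P(e^z, e^{p(z)}) = 0`, are Zariski dense in `W`, `I(W ∩ Γ_exp) = I(W)`.  Earlier files decided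
graph FIBRES over graph bases (`EACDensityCrossed`, `EACDensityAligned`: `y₀ = q(y₁)`,
`y₁ = q(y₀)`), dependent torus parts over graphs (`EACDensityDepGraph`) and ARBITRARY fibre curves
over LINES of real irrational slope (`ZilberEacRealFibreDensity`); this file closes the row
"graph base × general (non-graph) fibre curve" of the cell's node map.  Combined with those files,
Mantova–Masser's question is now decided for EVERY product surface `B × C` whose base `B` is a
line or a graph `x₁ = p(x₀)` / `x₀ = p(x₁)`.  This is a modest rung in the case ladder of EAC; it
is NOT Schanuel's conjecture (neither used nor implied; EAC ⇏ SC); `EC(3,2)` stays OPEN, and so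
does the density question over base curves that are not graphs over a coordinate axis.

Proof.  `ZilberEacGraphCurveEdge.exists_graphCurve_expPoints` (Newton-polygon edge of `P` +
root direction of `p + sX` + Hurwitz persistence) supplies exponential points of `W` whose base
coordinate `x₀ = z_k` escapes in a left sector, `|Re z_k| / log(2 + ‖z_k‖) → ∞`; the cell's
THEOREM G (`unprojectedDense_of_growth`: on an irreducible surface such a sequence is Zariski
generic) concludes.  Part B certifies `W` (irreducible closed of dimension `2`, as `Z(θ⁻¹(P̃))` for
the surjective substitution `θ : x₀ ↦ t, x₁ ↦ p(t), yᵢ ↦ yᵢ` into `ℂ[t, y₀, y₁]`, `P̃ = P(y₀, y₁)`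
prime there), exactly as `ZilberEacRealFibreDensity` did for lines.
-/

noncomputable section

open Filter Topology Metric Set Complex MvPolynomial
open Literature.NumberTheory.Transcendental Literature.ModelTheory.Zilber
open Literature.ModelTheory.ExponentialFields

set_option linter.dupNamespace false

namespace Summit.Schanuel.Schanuel.Theorems

/-! ## Part A. Density, structural form -/

/-- **Density from escaping exponential points** (any base polynomial `p`): if
`W = {x₁ = p(x₀), P(y₀, y₁) = 0}` is irreducible closed of dimension `≤ 2` and there are solutions
`z_k` of `P(e^{z_k}, e^{p(z_k)}) = 0` with `|Re z_k| / log(2 + ‖z_k‖) → ∞`, then the exponential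
points of `W` are Zariski dense (the cell's THEOREM G, `unprojectedDense_of_growth`). (new) -/
theorem unprojectedDense_graphCurveSurface_of_expPoints (p : Polynomial ℂ)
    (P : MvPolynomial (Fin 2) ℂ) {z : ℕ → ℂ}
    (hz : ∀ k, MvPolynomial.eval ![exp (z k), exp (p.eval (z k))] P = 0)
    (hgr : Tendsto (fun k => |(z k).re| / Real.log (2 + ‖z k‖)) atTop atTop)
    (hS : IsIrreducibleClosed ℂ {w : Fin 2 ⊕ Fin 2 → ℂ | w (Sum.inl 1) = p.eval (w (Sum.inl 0)) ∧
      MvPolynomial.eval (fun i => w (Sum.inr i)) P = 0})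
    (hdim : zariskiDim ℂ {w : Fin 2 ⊕ Fin 2 → ℂ | w (Sum.inl 1) = p.eval (w (Sum.inl 0)) ∧
      MvPolynomial.eval (fun i => w (Sum.inr i)) P = 0} ≤ (2 : ℕ)) :
    UnprojectedDense {w : Fin 2 ⊕ Fin 2 → ℂ | w (Sum.inl 1) = p.eval (w (Sum.inl 0)) ∧
      MvPolynomial.eval (fun i => w (Sum.inr i)) P = 0} := by
  set q : ℕ → Fin 2 ⊕ Fin 2 → ℂ := fun k =>
    Sum.elim ![z k, p.eval (z k)] ![exp (z k), exp (p.eval (z k))] with hq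
  have hqS : ∀ k, q k ∈ {w : Fin 2 ⊕ Fin 2 → ℂ | w (Sum.inl 1) = p.eval (w (Sum.inl 0)) ∧
      MvPolynomial.eval (fun i => w (Sum.inr i)) P = 0} := by
    intro k
    refine ⟨by simp [hq], ?_⟩
    have e : (fun i => q k (Sum.inr i)) = ![exp (z k), exp (p.eval (z k))] := by
      funext i; simp [hq]
    rw [e]; exact hz k
  have hqΓ : ∀ k, q k ∈ expGraph ℂ 2 := by
    intro k
    rw [mem_expGraph_iff]
    intro i
    rw [Literature.ModelTheory.ExponentialFields.ExponentialRing.complex_exp_eq]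
    fin_cases i <;> simp [hq]
  have hgr' : Tendsto (fun k => |(q k (Sum.inl 0)).re| / Real.log (2 + ‖q k (Sum.inl 0)‖))
      atTop atTop := by
    refine hgr.congr fun k => ?_
    simp [hq]
  exact unprojectedDense_of_growth hS hdim 0 hqS hqΓ hgr'

/-- **Density, structural form.**  If `deg p ≥ 2`, `P` has two monomials of different
`y₁`-degree, and `W = {x₁ = p(x₀), P(y₀, y₁) = 0}` is irreducible closed of dimension `≤ 2`, then
the exponential points of `W` are Zariski dense. (new) -/
theorem unprojectedDense_graphCurveSurface_of_isIrreducibleClosed (p : Polynomial ℂ)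
    (hd : 2 ≤ p.natDegree) (P : MvPolynomial (Fin 2) ℂ)
    (h2 : ∃ v ∈ P.support, ∃ v' ∈ P.support, v 1 ≠ v' 1)
    (hS : IsIrreducibleClosed ℂ {w : Fin 2 ⊕ Fin 2 → ℂ | w (Sum.inl 1) = p.eval (w (Sum.inl 0)) ∧
      MvPolynomial.eval (fun i => w (Sum.inr i)) P = 0})
    (hdim : zariskiDim ℂ {w : Fin 2 ⊕ Fin 2 → ℂ | w (Sum.inl 1) = p.eval (w (Sum.inl 0)) ∧
      MvPolynomial.eval (fun i => w (Sum.inr i)) P = 0} ≤ (2 : ℕ)) :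
    UnprojectedDense {w : Fin 2 ⊕ Fin 2 → ℂ | w (Sum.inl 1) = p.eval (w (Sum.inl 0)) ∧
      MvPolynomial.eval (fun i => w (Sum.inr i)) P = 0} := by
  obtain ⟨z, hz, hgr⟩ := exists_graphCurve_expPoints p hd P h2
  exact unprojectedDense_graphCurveSurface_of_expPoints p P hz hgr hS hdim

/-! ## Part B. The certificate: `{x₁ = p(x₀)} × Z(P)` is an irreducible surface -/

section Certificate

variable (p : Polynomial ℂ)

/-- `θ` (`x₀ ↦ t`, `x₁ ↦ p(t)`, `yᵢ ↦ yᵢ`) followed by evaluation at the parameter point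
`(w(x₀), w(y₀), w(y₁))` of `w ∈ {x₁ = p(x₀)} × ℂ²` is evaluation at `w`, on variables. -/
theorem eval_lcPt_graphCurveSubst {w : Fin 2 ⊕ Fin 2 → ℂ} (hw : w (Sum.inl 1) = p.eval (w (Sum.inl 0)))
    (v : Fin 2 ⊕ Fin 2) :
    eval (lcPt w) ((Sum.elim ![MvPolynomial.X 0, Polynomial.aeval (MvPolynomial.X 0 : MvPolynomial (Fin 3) ℂ) p]
      (fun i => MvPolynomial.X (Fin.succ i)) : Fin 2 ⊕ Fin 2 → MvPolynomial (Fin 3) ℂ) v) = w v := by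
  rcases v with i | i
  · fin_cases i
    · simp [lcPt]
    · show eval (lcPt w) (Polynomial.aeval (MvPolynomial.X 0 : MvPolynomial (Fin 3) ℂ) p) = w (Sum.inl 1)
      rw [eval_polynomial_aeval_X, hw]; rfl
  · simp [lcPt]

/-- `θ` followed by evaluation at the parameter point is evaluation at `w`. -/
theorem eval_lcPt_aeval_graphCurveSubst {w : Fin 2 ⊕ Fin 2 → ℂ}
    (hw : w (Sum.inl 1) = p.eval (w (Sum.inl 0))) (f : MvPolynomial (Fin 2 ⊕ Fin 2) ℂ) :
    eval (lcPt w) (aeval (Sum.elim ![MvPolynomial.X 0, Polynomial.aeval (MvPolynomial.X 0 : MvPolynomial (Fin 3) ℂ) p]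
      (fun i => MvPolynomial.X (Fin.succ i)) : Fin 2 ⊕ Fin 2 → MvPolynomial (Fin 3) ℂ) f) = aeval w f := by
  have h : (fun v => eval (lcPt w) ((Sum.elim ![MvPolynomial.X 0, Polynomial.aeval (MvPolynomial.X 0 : MvPolynomial (Fin 3) ℂ) p]
      (fun i => MvPolynomial.X (Fin.succ i)) : Fin 2 ⊕ Fin 2 → MvPolynomial (Fin 3) ℂ) v)) = w :=
    funext (eval_lcPt_graphCurveSubst p hw)
  rw [eval_aeval_eq_aeval, h]

/-- `θ` is onto (`t ↦ x₀`, `yᵢ ↦ yᵢ` is a section). -/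
theorem graphCurveSubst_surjective : Function.Surjective
    (aeval (Sum.elim ![MvPolynomial.X 0, Polynomial.aeval (MvPolynomial.X 0 : MvPolynomial (Fin 3) ℂ) p]
      (fun i => MvPolynomial.X (Fin.succ i)) : Fin 2 ⊕ Fin 2 → MvPolynomial (Fin 3) ℂ) :
      MvPolynomial (Fin 2 ⊕ Fin 2) ℂ →ₐ[ℂ] MvPolynomial (Fin 3) ℂ) := by
  intro r
  let back : Fin 3 → Fin 2 ⊕ Fin 2 := Fin.cases (Sum.inl 0) (fun i => Sum.inr i)
  refine ⟨rename back r, ?_⟩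
  rw [aeval_rename]
  have hX : ((Sum.elim ![MvPolynomial.X 0, Polynomial.aeval (MvPolynomial.X 0 : MvPolynomial (Fin 3) ℂ) p]
      (fun i => MvPolynomial.X (Fin.succ i)) : Fin 2 ⊕ Fin 2 → MvPolynomial (Fin 3) ℂ) ∘ back) = MvPolynomial.X := by
    funext j
    refine Fin.cases ?_ (fun i => ?_) j
    · simp [back]
    · simp [back]
  rw [hX, MvPolynomial.aeval_X_left_apply]

/-- **`W(p; P) = Z(θ⁻¹((P̃)))`**, `P̃ = P(y₀, y₁) ∈ ℂ[t, y₀, y₁]`. -/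
theorem graphCurveSurface_eq_zeroLocus (P : MvPolynomial (Fin 2) ℂ) :
    {w : Fin 2 ⊕ Fin 2 → ℂ | w (Sum.inl 1) = p.eval (w (Sum.inl 0)) ∧
      MvPolynomial.eval (fun i => w (Sum.inr i)) P = 0} =
    zeroLocus ℂ (Ideal.comap (aeval (Sum.elim ![MvPolynomial.X 0, Polynomial.aeval (MvPolynomial.X 0 : MvPolynomial (Fin 3) ℂ) p]
      (fun i => MvPolynomial.X (Fin.succ i)) : Fin 2 ⊕ Fin 2 → MvPolynomial (Fin 3) ℂ) :
        MvPolynomial (Fin 2 ⊕ Fin 2) ℂ →ₐ[ℂ] MvPolynomial (Fin 3) ℂ)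
      (Ideal.span {rename Fin.succ P})) := by
  ext w
  rw [mem_zeroLocus_iff]
  constructor
  · rintro ⟨hw1, hwP⟩ f hf
    rw [Ideal.mem_comap, Ideal.mem_span_singleton] at hf
    obtain ⟨r, hr⟩ := hf
    rw [← eval_lcPt_aeval_graphCurveSubst p hw1, hr, map_mul, eval_rename]
    have e : (lcPt w ∘ Fin.succ) = fun i => w (Sum.inr i) := funext fun i => by simp [lcPt]
    rw [e, hwP, zero_mul]
  · intro h
    constructor
    · have hmem : (MvPolynomial.X (Sum.inl 1) - Polynomial.aeval (MvPolynomial.X (Sum.inl 0) : MvPolynomial (Fin 2 ⊕ Fin 2) ℂ) p :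
          MvPolynomial (Fin 2 ⊕ Fin 2) ℂ) ∈
          Ideal.comap (aeval (Sum.elim ![MvPolynomial.X 0, Polynomial.aeval (MvPolynomial.X 0 : MvPolynomial (Fin 3) ℂ) p]
            (fun i => MvPolynomial.X (Fin.succ i)) : Fin 2 ⊕ Fin 2 → MvPolynomial (Fin 3) ℂ) :
              MvPolynomial (Fin 2 ⊕ Fin 2) ℂ →ₐ[ℂ] MvPolynomial (Fin 3) ℂ)
            (Ideal.span {rename Fin.succ P}) := by
        rw [Ideal.mem_comap]
        have e : aeval (Sum.elim ![MvPolynomial.X 0, Polynomial.aeval (MvPolynomial.X 0 : MvPolynomial (Fin 3) ℂ) p]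
            (fun i => MvPolynomial.X (Fin.succ i)) : Fin 2 ⊕ Fin 2 → MvPolynomial (Fin 3) ℂ)
            (MvPolynomial.X (Sum.inl 1) - Polynomial.aeval (MvPolynomial.X (Sum.inl 0) : MvPolynomial (Fin 2 ⊕ Fin 2) ℂ) p :
              MvPolynomial (Fin 2 ⊕ Fin 2) ℂ) = 0 := by
          rw [map_sub, ← Polynomial.aeval_algHom_apply, MvPolynomial.aeval_X, MvPolynomial.aeval_X]
          simp
        rw [e]; exact Ideal.zero_mem _
      have h1 := h _ hmem
      rw [map_sub, MvPolynomial.aeval_X, sub_eq_zero] at h1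
      rw [h1, aeval_polynomial_aeval_X]
    · have hmem : (rename Sum.inr P : MvPolynomial (Fin 2 ⊕ Fin 2) ℂ) ∈
          Ideal.comap (aeval (Sum.elim ![MvPolynomial.X 0, Polynomial.aeval (MvPolynomial.X 0 : MvPolynomial (Fin 3) ℂ) p]
            (fun i => MvPolynomial.X (Fin.succ i)) : Fin 2 ⊕ Fin 2 → MvPolynomial (Fin 3) ℂ) :
              MvPolynomial (Fin 2 ⊕ Fin 2) ℂ →ₐ[ℂ] MvPolynomial (Fin 3) ℂ)
            (Ideal.span {rename Fin.succ P}) := by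
        have hfg : ((Sum.elim ![MvPolynomial.X 0, Polynomial.aeval (MvPolynomial.X 0 : MvPolynomial (Fin 3) ℂ) p]
            (fun i => MvPolynomial.X (Fin.succ i)) : Fin 2 ⊕ Fin 2 → MvPolynomial (Fin 3) ℂ) ∘ Sum.inr) =
            MvPolynomial.X ∘ Fin.succ := funext fun i => by simp
        rw [Ideal.mem_comap, aeval_rename, hfg, ← rename_eq_aeval (R := ℂ) Fin.succ]
        exact Ideal.mem_span_singleton_self _
      have h1 := h _ hmem
      rw [aeval_rename] at h1
      exact h1

variable {P : MvPolynomial (Fin 2) ℂ}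

/-- **`W(p; P)` is an irreducible closed set** for irreducible `P`. (new) -/
theorem isIrreducibleClosed_graphCurveSurface (hirr : Irreducible P) :
    IsIrreducibleClosed ℂ {w : Fin 2 ⊕ Fin 2 → ℂ | w (Sum.inl 1) = p.eval (w (Sum.inl 0)) ∧
      MvPolynomial.eval (fun i => w (Sum.inr i)) P = 0} := by
  have hprime := prime_rename_succ hirr
  haveI : (Ideal.span {rename Fin.succ P} : Ideal (MvPolynomial (Fin 3) ℂ)).IsPrime :=
    (Ideal.span_singleton_prime hprime.ne_zero).2 hprime
  haveI : (Ideal.comap (aeval (Sum.elim ![MvPolynomial.X 0, Polynomial.aeval (MvPolynomial.X 0 : MvPolynomial (Fin 3) ℂ) p]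
      (fun i => MvPolynomial.X (Fin.succ i)) : Fin 2 ⊕ Fin 2 → MvPolynomial (Fin 3) ℂ) :
        MvPolynomial (Fin 2 ⊕ Fin 2) ℂ →ₐ[ℂ] MvPolynomial (Fin 3) ℂ)
      (Ideal.span {rename Fin.succ P})).IsPrime := Ideal.IsPrime.comap _
  rw [graphCurveSurface_eq_zeroLocus]
  exact isIrreducibleClosed_zeroLocus _

/-- **`dim W(p; P) = 2`**: `ℂ[W] ≅ ℂ[t, y₀, y₁]/(P̃)`, a hypersurface ring in three variables.
(new) -/
theorem zariskiDim_graphCurveSurface (hirr : Irreducible P) :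
    zariskiDim ℂ {w : Fin 2 ⊕ Fin 2 → ℂ | w (Sum.inl 1) = p.eval (w (Sum.inl 0)) ∧
      MvPolynomial.eval (fun i => w (Sum.inr i)) P = 0} = (2 : ℕ) := by
  have hprime := prime_rename_succ hirr
  haveI : (Ideal.span {rename Fin.succ P} : Ideal (MvPolynomial (Fin 3) ℂ)).IsPrime :=
    (Ideal.span_singleton_prime hprime.ne_zero).2 hprime
  haveI : (Ideal.comap (aeval (Sum.elim ![MvPolynomial.X 0, Polynomial.aeval (MvPolynomial.X 0 : MvPolynomial (Fin 3) ℂ) p]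
      (fun i => MvPolynomial.X (Fin.succ i)) : Fin 2 ⊕ Fin 2 → MvPolynomial (Fin 3) ℂ) :
        MvPolynomial (Fin 2 ⊕ Fin 2) ℂ →ₐ[ℂ] MvPolynomial (Fin 3) ℂ)
      (Ideal.span {rename Fin.succ P})).IsPrime := Ideal.IsPrime.comap _
  rw [graphCurveSurface_eq_zeroLocus, zariskiDim_zeroLocus_eq]
  set J : Ideal (MvPolynomial (Fin 3) ℂ) := Ideal.span {rename Fin.succ P} with hJ
  let f : MvPolynomial (Fin 2 ⊕ Fin 2) ℂ →ₐ[ℂ] (MvPolynomial (Fin 3) ℂ ⧸ J) :=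
    (Ideal.Quotient.mkₐ ℂ J).comp (aeval (Sum.elim ![MvPolynomial.X 0, Polynomial.aeval (MvPolynomial.X 0 : MvPolynomial (Fin 3) ℂ) p]
      (fun i => MvPolynomial.X (Fin.succ i)) : Fin 2 ⊕ Fin 2 → MvPolynomial (Fin 3) ℂ))
  have hf : Function.Surjective f :=
    (Ideal.Quotient.mkₐ_surjective ℂ J).comp (graphCurveSubst_surjective p)
  have hker : RingHom.ker f = Ideal.comap (aeval (Sum.elim ![MvPolynomial.X 0, Polynomial.aeval (MvPolynomial.X 0 : MvPolynomial (Fin 3) ℂ) p]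
      (fun i => MvPolynomial.X (Fin.succ i)) : Fin 2 ⊕ Fin 2 → MvPolynomial (Fin 3) ℂ) :
        MvPolynomial (Fin 2 ⊕ Fin 2) ℂ →ₐ[ℂ] MvPolynomial (Fin 3) ℂ) J := by
    ext q
    simp only [RingHom.mem_ker, Ideal.mem_comap, f, AlgHom.comp_apply,
      Ideal.Quotient.mkₐ_eq_mk, Ideal.Quotient.eq_zero_iff_mem]
  rw [← hker, ringKrullDim_eq_of_ringEquiv (Ideal.quotientKerAlgEquivOfSurjective hf).toRingEquiv,
    hJ, Literature.RingTheory.KrullDimension.ringKrullDim_quotient_span_of_prime_mvPolynomial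
      hprime]

end Certificate

/-! ## Part C. The main theorems -/

/-- **MAIN THEOREM. Zariski density of the exponential points of `{x₁ = p(x₀)} × Z(P)`**
(`deg p ≥ 2`; `P ∈ ℂ[y₀, y₁]` irreducible with two monomials of different `y₁`-degree — i.e.
`Z(P)` is any irreducible plane curve other than a vertical line `y₀ = r`): the solutions of
`P(e^z, e^{p(z)}) = 0` give a Zariski dense set of points `(z, p(z), e^z, e^{p(z)})` of `W`,
`I(W ∩ Γ_exp) = I(W)`.  An instance class of Mantova–Masser's open density question; a modest
rung of EAC, NOT Schanuel's conjecture.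
[cite: MantovaMasser2023, §1 Further remarks, p. 5 (the question, open in general)] (new) -/
theorem unprojectedDense_graphCurveSurface (p : Polynomial ℂ) (hd : 2 ≤ p.natDegree)
    {P : MvPolynomial (Fin 2) ℂ} (hirr : Irreducible P)
    (h2 : ∃ v ∈ P.support, ∃ v' ∈ P.support, v 1 ≠ v' 1) :
    UnprojectedDense {w : Fin 2 ⊕ Fin 2 → ℂ | w (Sum.inl 1) = p.eval (w (Sum.inl 0)) ∧
      MvPolynomial.eval (fun i => w (Sum.inr i)) P = 0} :=
  unprojectedDense_graphCurveSurface_of_isIrreducibleClosed p hd P h2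
    (isIrreducibleClosed_graphCurveSurface p hirr) (by rw [zariskiDim_graphCurveSurface p hirr])

/-- **Coordinate reading.**  Under the same hypotheses, a polynomial `G ∈ ℂ[x₀, x₁, y₀, y₁]` with
`G(z, p(z), e^z, e^{p(z)}) = 0` for every solution `z` of `P(e^z, e^{p(z)}) = 0` vanishes on all of
`{x₁ = p(x₀)} × Z(P)`. (new) -/
theorem aeval_eq_zero_of_graphCurve_expPoints (p : Polynomial ℂ) (hd : 2 ≤ p.natDegree)
    {P : MvPolynomial (Fin 2) ℂ} (hirr : Irreducible P)
    (h2 : ∃ v ∈ P.support, ∃ v' ∈ P.support, v 1 ≠ v' 1) (G : MvPolynomial (Fin 2 ⊕ Fin 2) ℂ)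
    (hG : ∀ z : ℂ, MvPolynomial.eval ![exp z, exp (p.eval z)] P = 0 →
      aeval (Sum.elim ![z, p.eval z] ![exp z, exp (p.eval z)]) G = 0)
    {w : Fin 2 ⊕ Fin 2 → ℂ} (hw1 : w (Sum.inl 1) = p.eval (w (Sum.inl 0)))
    (hw2 : MvPolynomial.eval (fun i => w (Sum.inr i)) P = 0) : aeval w G = 0 := by
  have hdense := unprojectedDense_graphCurveSurface p hd hirr h2
  have hGI : G ∈ vanishingIdeal ℂ ({w : Fin 2 ⊕ Fin 2 → ℂ | w (Sum.inl 1) = p.eval (w (Sum.inl 0)) ∧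
      MvPolynomial.eval (fun i => w (Sum.inr i)) P = 0} ∩ expGraph ℂ 2) := by
    rw [mem_vanishingIdeal_iff]
    rintro t ⟨⟨ht1, ht2⟩, htΓ⟩
    rw [mem_expGraph_iff] at htΓ
    have h0 := htΓ 0
    have h1 := htΓ 1
    rw [Literature.ModelTheory.ExponentialFields.ExponentialRing.complex_exp_eq] at h0 h1
    have ht : t = Sum.elim ![t (Sum.inl 0), p.eval (t (Sum.inl 0))]
        ![exp (t (Sum.inl 0)), exp (p.eval (t (Sum.inl 0)))] := by
      funext v
      rcases v with j | j <;> fin_cases j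
      · rfl
      · exact ht1
      · exact h0
      · simp only [Fin.mk_one, Sum.elim_inr, Matrix.cons_val_one, Matrix.cons_val_fin_one]
        rw [h1, ht1]
    rw [ht]
    refine hG _ ?_
    have e : (![exp (t (Sum.inl 0)), exp (p.eval (t (Sum.inl 0)))] : Fin 2 → ℂ) =
        fun i => t (Sum.inr i) := by
      funext i
      fin_cases i
      · simp [h0]
      · simp [h1, ht1]
    rw [e]; exact ht2
  rw [UnprojectedDense] at hdense
  rw [hdense, mem_vanishingIdeal_iff] at hGI
  exact hGI w ⟨hw1, hw2⟩

end Summit.Schanuel.Schanuel.Theorems
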